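import Summits.BirchSwinnertonDyer.Rank1Residual.Additive.X4RankZeroKatoBound
import Literature.NumberTheory.EllipticCurves.Kato2004.MainConjectureDescentSkeletonProofs
import Literature.NumberTheory.EllipticCurves.Kato2004.AdditivePotGoodRankZeroShaUpperBound
import Literature.NumberTheory.EllipticCurves.Kato2004.Condition1252
import Literature.NumberTheory.EllipticCurves.NonEisensteinPrimeOfSurjective
import HarnessLib

/-!
# The Kato DESCENT DATUM at an additive potentially good prime (interface), the three printed READINGS
# over it, and the rank-`0` `#Ш_an` bookkeeping — part 1 of the descent `KMC_p(f_E)⁰ ⟺ BSD_p`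
# (cell `bsd-potss`, seat `kmc`; consumer: `Additive/KMCTrivialDescentRankZero.lean`)

HONEST FRAMING (cell `bsd-potss`, `run/shared/lean/pub/bsd-potss/`, FULL-BSD rank-`≤ 1` programme
tranche 1b, rows B4/B5 = O5/O6, construction K9 "descent KMC ⇒ BSD_p at an additive potentially
supersingular prime"; typed against the class shells of cell `b2b-bsdres`, lane CLASS-CLOSURE —
`Additive/PotSupersingularTargets.lean`, `O5/O5Targets.lean`, `O6/O6Targets.lean`,
`O6/MainConjectureEvenIffBSD.lean`): NOTHING about Kato's Main Conjecture is asserted and no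
Literature fact is minted. Kato's objects `𝐇¹(T)`, `z_γ^{(p)}`, `𝐇²(T)`, `H^q(ℤ[1/p], j_*T)`
(Astérisque 295, 8.1/12.1–12.5/§14) are not tree objects: they enter as the INTERFACE
`KatoDescentDatum` + the interface predicate `IsOf` (a section variable; definition request of the
D-O6-2 / D-O5-GV-1 kind), and the printed theorems about them enter as hypothesis SCHEMATA with
locators (§2), never as facts. Census numbers are not inputs; nothing is booked; no mark of
`RESIDUAL-MAP.md` moves.

## Contents

§1 `KatoDescentDatum p` — Kato's §14.14 data on the `Δ`-TRIVIAL component of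
`Λ = ℤ_p⟦Gal(ℚ(ζ_{p^∞})/ℚ)⟧ = ⊕_{Δ̂} ℤ_p⟦Γ⟧`, as abstract `ℤ_p⟦T⟧ = IwasawaAlgebra p`-modules: `H`
(`𝐇¹(T)⁰`, finitely generated torsion free — Thm. 12.4 (2)), `z ∈ H` non-zero with `H/Λz` torsion
(the zeta element; integral by Thm. 12.5 (4) under `p ≠ 2` + (12.5.2)), `H2` (`𝐇²(T)⁰`, finitely
generated torsion — 12.4 (1)), `A` (`H¹(ℤ[1/p], j_*T)`) with (14.14.1) `0 → H/TH →ι A →π H2[T] → 0`;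
`D.Conj1210` = Conj. 12.10 on this component, `D.Divisibility` = the inequality of Thm. 12.5 (4),
`D.zetaIndex = [A : Λ·ι z̄]` (= `[H¹(ℤ[1/p],T) : z]`), `D.h2Card = #(H2/TH2)` (= `#H²(ℤ[1/p],T)` by
(14.14.2)); and the two DESCENTS as tree theorems on the datum
(`Kato2004/MainConjectureDescentSkeletonProofs.lean`, this seat): `Conj1210 ⇒ zetaIndex = h2Card`
(`μ = 1`) and `zetaIndex = h2Card ∧ Divisibility ⇒ Conj1210`.

§2 THE READINGS (hypothesis schemata over `IsOf`; each a printed theorem applied to `T_pW`):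
`DescentCountReading` — Thm. 14.5 (1) + the TAMAGAWA-EXACT COUNT WITH `μ` KEPT
(`ord_p #Ш(E)(p) + v_p(Tam E) + m = ord_p(L(E,1)/Ω)`, `[H¹ : z] = p^m #H²`: Prop. 14.16 (2), §14.8
with Greenberg LNM 1716 Prop. 4.13/§3 = Lemma T, the local index `exp*_ω(H¹(ℚ_p,T)) = c_p·p^{−t}ℤ_p`
of C.-H. Kim AJM 2026 §3.2.3 / Kato Lemma 14.18 / [BK2] 3.8, the period of Prop. 14.21/14.22 — items
1–5 of the audited derivation of the tree fact
`Kato2004.rankZero_padicValNat_sha_add_padicValNat_tamagawa_le_of_additive_potGood_of_imageContainsSL2`,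
which is this reading with `m` forgotten: `descentCountReading_implies_tamagawaExact`);
`DivisibilityReading` — Thm. 12.5 (4); `Realizable` — a datum exists (12.4, 12.5 (4), §14.14);
`ReadsTrivialKMC KMC` — the interface lemma `KMC W p ↔ D.Conj1210`.

§3 Rank-`0` bookkeeping: `L(E,1)/Ω = q`, `ord_p #Ш(p) + v_p(Tam) + m = ord_p q` ⊢ `#Ш_an = q' ∈ ℚ`
with `ord_p #Ш_an = ord_p #Ш + m` (`p ∤ #E(ℚ)_tors` under (12.5.2)); hence the UPPER half always and
the LOWER half iff `m = 0`.

References: K. Kato, Astérisque 295 (2004): Thm. 12.4 (p. 221), Thm. 12.5 (4) and (12.5.2)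
(p. 222), Conj. 12.10 (p. 224), Thm. 14.5 (pp. 236–237), §14.8–14.10, §14.14 (14.14.1)–(14.14.2)
and Lemma 14.15 (pp. 243–244), Prop. 14.16 (p. 244), Lemma 14.18, Prop. 14.21–14.22 (pp. 247–249)
[Kato2004Asterisque]; R. Greenberg, LNM 1716 (1999) Prop. 4.13, §3 [GreenbergLNM1716]; C.-H. Kim,
AJM 148 (2026) §3.2.3 [Kim2022StructureSelmer]; R. L. Miller, LMS JCM 14 (2011) Def. 1.1
[Miller2011LMS]; B. Mazur 1977 III.5 (torsion under (irr)) [Mazur1977].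
-/

set_option autoImplicit false

noncomputable section

open scoped Classical

open WeierstrassCurve Literature.NumberTheory.EllipticCurves
  Literature.NumberTheory.EllipticCurves.ModularForms
  Literature.NumberTheory.EllipticCurves.Rank1Residual
  Literature.NumberTheory.EllipticCurves.Rank1Residual.Typed
  Literature.NumberTheory.EllipticCurves.IwasawaAlgebra

namespace Summit.BirchSwinnertonDyer.Rank1Residual.Additive

/-! ## §1 The interface: a Kato descent datum on the trivial component, and the two descents -/

/-- **INTERFACE (definition request, D-O6-2 shape): Kato's §14.14 descent data for `(T, p)` on the
`Δ`-trivial component, as abstract `Λ = ℤ_p⟦T⟧`-modules.** `H` = `𝐇¹(T)⁰` (finitely generated,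
torsion free: Thm. 12.4 (2)); `z` = the component of the zeta element `z_γ^{(p)}` (`γ⁺` an `O`-basis
of `T(−1)⁺`; `z ∈ 𝐇¹(T)` by Thm. 12.5 (4) under `p ≠ 2` + (12.5.2)), `z ≠ 0` with `H/Λz` torsion
(`𝐇¹` has `Λ ⊗ ℚ`-rank one, 12.4 (2)); `H2` = `𝐇²(T)⁰` (finitely generated torsion, 12.4 (1)); `A` =
`H¹(ℤ[1/p], j_*T)` (a `Λ`-module through `Λ → Λ/T = ℤ_p`) with the exact sequence (14.14.1)
`0 → H/TH →ι A →π H2[T] → 0`. The structure only NAMES modules and maps; "`D` IS Kato's datum for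
`(T_pW)⁰`" is the interface predicate `IsKatoDescentDatumOf` (a section variable below), never a
hypothesis smuggled into a certificate. [cite: Kato2004Asterisque, Thm. 12.4 (p. 221), Thm. 12.5 (4) (p. 222), §14.14 (14.14.1) (p. 243)] -/
structure KatoDescentDatum (p : ℕ) [Fact p.Prime] : Type 1 where
  /-- `𝐇¹(T)⁰`. -/
  H : Type
  [acgH : AddCommGroup H]
  [modH : Module (IwasawaAlgebra p) H]
  [finH : Module.Finite (IwasawaAlgebra p) H]
  [tfH : NoZeroSMulDivisors (IwasawaAlgebra p) H]
  /-- the zeta element `(z_γ^{(p)})⁰ ∈ 𝐇¹(T)⁰`. -/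
  z : H
  z_ne_zero : z ≠ 0
  /-- `𝐇¹(T)⁰/Λz` is torsion (`𝐇¹` has rank one). -/
  isTorsion_quotient : Module.IsTorsion (IwasawaAlgebra p) (H ⧸ (IwasawaAlgebra p) ∙ z)
  /-- `𝐇²(T)⁰`. -/
  H2 : Type
  [acgH2 : AddCommGroup H2]
  [modH2 : Module (IwasawaAlgebra p) H2]
  [finH2 : Module.Finite (IwasawaAlgebra p) H2]
  isTorsion_H2 : Module.IsTorsion (IwasawaAlgebra p) H2
  /-- `H¹(ℤ[1/p], j_*T)`. -/
  A : Type
  [acgA : AddCommGroup A]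
  [modA : Module (IwasawaAlgebra p) A]
  /-- (14.14.1), first map. -/
  ι : coinvariants p H →ₗ[IwasawaAlgebra p] A
  /-- (14.14.1), second map. -/
  π : A →ₗ[IwasawaAlgebra p] invariants p H2
  ι_injective : Function.Injective ι
  π_surjective : Function.Surjective π
  exact_ι_π : Function.Exact ι π

namespace KatoDescentDatum

variable {p : ℕ} [Fact p.Prime] (D : KatoDescentDatum p)

/-- The bundled abelian-group structure of `D.H`. [folklore] -/
instance instAddCommGroupH : AddCommGroup D.H := D.acgH
/-- The bundled `Λ`-module structure of `D.H`. [folklore] -/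
instance instModuleH : Module (IwasawaAlgebra p) D.H := D.modH
/-- `D.H` is finitely generated (bundled). [folklore] -/
instance instFiniteH : Module.Finite (IwasawaAlgebra p) D.H := D.finH
/-- `D.H` is torsion free (bundled). [folklore] -/
instance instNoZeroSMulDivisorsH : NoZeroSMulDivisors (IwasawaAlgebra p) D.H := D.tfH
/-- The bundled abelian-group structure of `D.H2`. [folklore] -/
instance instAddCommGroupH2 : AddCommGroup D.H2 := D.acgH2
/-- The bundled `Λ`-module structure of `D.H2`. [folklore] -/
instance instModuleH2 : Module (IwasawaAlgebra p) D.H2 := D.modH2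
/-- `D.H2` is finitely generated (bundled). [folklore] -/
instance instFiniteH2 : Module.Finite (IwasawaAlgebra p) D.H2 := D.finH2
/-- The bundled abelian-group structure of `D.A`. [folklore] -/
instance instAddCommGroupA : AddCommGroup D.A := D.acgA
/-- The bundled `Λ`-module structure of `D.A`. [folklore] -/
instance instModuleA : Module (IwasawaAlgebra p) D.A := D.modA

end KatoDescentDatum

namespace KatoDescentDatum

variable {p : ℕ} [Fact p.Prime] (D : KatoDescentDatum p)

/-- **Kato's Conjecture 12.10 for the datum** (on this component): at every height-one prime `𝔮` of
`Λ`, `length_{Λ_𝔮} (H2)_𝔮 = length_{Λ_𝔮} (H/Λz)_𝔮`. [cite: Kato2004Asterisque, Conj. 12.10 (p. 224)] -/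
def Conj1210 : Prop :=
  ∀ 𝔮 : PrimeSpectrum (IwasawaAlgebra p), 𝔮.asIdeal.height = 1 →
    Module.lengthAt (IwasawaAlgebra p) D.H2 𝔮 =
      Module.lengthAt (IwasawaAlgebra p) (D.H ⧸ (IwasawaAlgebra p) ∙ D.z) 𝔮

/-- **The inequality of Kato's Theorem 12.5 (4) for the datum**: `length (H2)_𝔮 ≤ length (H/Λz)_𝔮` at
every height-one `𝔮`. [cite: Kato2004Asterisque, Thm. 12.5 (4) (p. 222)] -/
def Divisibility : Prop :=
  ∀ 𝔮 : PrimeSpectrum (IwasawaAlgebra p), 𝔮.asIdeal.height = 1 →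
    Module.lengthAt (IwasawaAlgebra p) D.H2 𝔮 ≤
      Module.lengthAt (IwasawaAlgebra p) (D.H ⧸ (IwasawaAlgebra p) ∙ D.z) 𝔮

/-- **Kato's index `[H¹(ℤ[1/p],T) : z] = [A : Λ·ι(z̄)]`** (p. 236, with `y = z`, `c = 1`).
[cite: Kato2004Asterisque, Thm. 14.5 and the definition of `[M : z]` (pp. 236–237)] -/
def zetaIndex : ℕ :=
  Nat.card (D.A ⧸ (IwasawaAlgebra p) ∙ D.ι (Submodule.Quotient.mk D.z))

/-- **`#H²(ℤ[1/p],T) = #(𝐇²(T)/a𝐇²(T))`** ((14.14.2)), as `#(H2/TH2)`.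
[cite: Kato2004Asterisque, §14.14 (14.14.2) (p. 243)] -/
def h2Card : ℕ :=
  Nat.card (coinvariants p D.H2)

/-- **The descent (Kato §14.14–14.15 run with Conj. 12.10; tree theorem
`Kato2004.index_zeta_eq_natCard_coinvariants_of_conj_12_10`): `Conj1210 ⇒ [A : z] = #(H2/TH2)`**, i.e.
`μ = 1`, when `H2/TH2` is finite. [cite: Kato2004Asterisque, §14.14 and Lemma 14.15 (pp. 243–244), Conj. 12.10 (p. 224)] -/
theorem zetaIndex_eq_h2Card_of_conj1210 (hfin : Finite (coinvariants p D.H2)) (h : D.Conj1210) :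
    D.zetaIndex = D.h2Card :=
  Kato2004.index_zeta_eq_natCard_coinvariants_of_conj_12_10 D.z D.z_ne_zero D.isTorsion_quotient
    D.isTorsion_H2 h D.ι D.π D.ι_injective D.π_surjective D.exact_ι_π hfin

/-- **The converse descent (tree theorem `Kato2004.lengthAt_eq_of_index_zeta_eq_natCard_coinvariants`):
`[A : z] = #(H2/TH2)` and the divisibility of Thm. 12.5 (4) ⇒ `Conj1210`.**
[cite: Kato2004Asterisque, Thm. 12.5 (4) (p. 222), §14.14 (p. 243), Conj. 12.10 (p. 224)] -/
theorem conj1210_of_zetaIndex_eq_h2Card (hfin : Finite (coinvariants p D.H2)) (hdiv : D.Divisibility)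
    (h : D.zetaIndex = D.h2Card) : D.Conj1210 :=
  Kato2004.lengthAt_eq_of_index_zeta_eq_natCard_coinvariants D.z D.z_ne_zero D.isTorsion_quotient
    D.isTorsion_H2 hdiv D.ι D.π D.ι_injective D.π_surjective D.exact_ι_π hfin h

/-- `#(H2/TH2) ≥ 1` when finite (it is the order of a finite group). [folklore] -/
theorem h2Card_pos (hfin : Finite (coinvariants p D.H2)) : 0 < D.h2Card := by
  haveI := hfin
  exact Nat.card_pos

/-- With `[A : z] = p^m · #(H2/TH2)` and `H2/TH2` finite: **`μ = 1 ⟺ m = 0`**. [folklore] -/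
theorem zetaIndex_eq_h2Card_iff {m : ℕ} (hfin : Finite (coinvariants p D.H2))
    (hm : D.zetaIndex = p ^ m * D.h2Card) : D.zetaIndex = D.h2Card ↔ m = 0 := by
  have hpos := D.h2Card_pos hfin
  have hp : 1 < p := (Fact.out : p.Prime).one_lt
  constructor
  · intro h
    rw [h] at hm
    have h1 : p ^ m = 1 := by
      have : 1 * D.h2Card = p ^ m * D.h2Card := by rw [one_mul]; exact hm
      exact (Nat.eq_of_mul_eq_mul_right hpos this).symm
    exact (Nat.pow_eq_one.mp h1).resolve_left hp.ne'
  · intro h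
    rw [hm, h, pow_zero, one_mul]

end KatoDescentDatum

/-! ## §2 The readings (hypothesis schemata over the interface predicate; nothing asserted) -/

section Readings

variable (IsOf : ∀ (W : WeierstrassCurve ℚ) [W.IsElliptic] [W.IsGloballyMinimal] (p : ℕ) [Fact p.Prime],
  KatoDescentDatum p → Prop)
variable (KMC : ∀ (W : WeierstrassCurve ℚ) [W.IsElliptic] [W.IsGloballyMinimal] (p : ℕ), Prop)

/-- **READING 1 — the Tamagawa-exact count WITH `μ` KEPT (Kato Thm. 14.5 (1), (3); Prop. 14.16 (2);
§14.8 with Greenberg's Prop. 4.13 / §3 (Lemma T); the local index at an additive `p`; the period of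
Prop. 14.21/14.22).** For `W/ℚ` globally minimal, `p ≠ 2` additive and potentially good, (12.5.2),
`L(E,1) ≠ 0`, `Ш(E)` finite, and a realised datum `D`: `H²(ℤ[1/p],T)` is finite (14.5 (1)), and there
are `q ∈ ℚ`, `m ∈ ℕ` with `L(E,1)/Ω(W) = q`, `[H¹(ℤ[1/p],T) : z] = p^m · #H²(ℤ[1/p],T)` (`μ = p^m`,
`m ≥ 0` = Thm. 14.5 (3)) and **`ord_p #Ш(E)(p) + v_p(Tam E) + m = ord_p q`** (Prop. 14.16 (2):
`#S(T) = μ^{-1} ν #H⁰ #H⁰` with `#H⁰ = 1` under (12.5.2), `#S(T) = #Ш[p^∞] ∏_{ℓ≠p} c_ℓ^{(p)}` (Lemma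
T), `ν = p^{ord_p(L/Ω) − v_p(c_p)}`) — VERBATIM items 1–5 of the derivation of the tree fact
`Kato2004.rankZero_padicValNat_sha_add_padicValNat_tamagawa_le_of_additive_potGood_of_imageContainsSL2`
(audit `KATO2004-TYPING.md` §29), which is this reading with `m` forgotten
(`descentCountReading_implies_tamagawaExact`). Hypothesis schema; nothing asserted.
[cite: Kato2004Asterisque, Thm. 14.5 (1)(3) (p. 236), Prop. 14.16 (2) (p. 244), §14.8 (p. 238), Prop. 14.21–14.22 (pp. 248–249)]
[cite: GreenbergLNM1716, Prop. 4.13 and §3 after Lemma 3.3] [cite: Kim2022StructureSelmer, §3.2.3 display before Thm. 3.7 (PDF p. 16)] -/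
def DescentCountReading : Prop :=
  ∀ (W : WeierstrassCurve ℚ) [W.IsElliptic] [W.IsGloballyMinimal] (p : ℕ) [Fact p.Prime]
    (D : KatoDescentDatum p),
    p ≠ 2 → Addv W p → 0 ≤ padicValRat p W.j → Kato2004.ImageContainsSL2 W p →
    W.entireLFunction 1 ≠ 0 → Finite W.sha → IsOf W p D →
    Finite (coinvariants p D.H2) ∧
      ∃ (q : ℚ) (m : ℕ), W.entireLFunction 1 / (W.realPeriodRat : ℂ) = (q : ℂ) ∧
        D.zetaIndex = p ^ m * D.h2Card ∧
        (padicValNat p (Nat.card (AddCommGroup.primaryComponent W.sha p)) : ℤ) +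
            padicValNat p W.tamagawaProduct + m = padicValRat p q

/-- **READING 2 — the divisibility of Kato's Theorem 12.5 (4)** (`p ≠ 2`, (12.5.2); the exception
(12.5.1) does not occur at a potentially good `p`, Remark 12.7) for a realised datum. Hypothesis
schema; nothing asserted. [cite: Kato2004Asterisque, Thm. 12.5 (4) and (12.5.1)–(12.5.2) (p. 222), Remark 12.7 (p. 222)] -/
def DivisibilityReading : Prop :=
  ∀ (W : WeierstrassCurve ℚ) [W.IsElliptic] [W.IsGloballyMinimal] (p : ℕ) [Fact p.Prime]
    (D : KatoDescentDatum p),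
    p ≠ 2 → Addv W p → 0 ≤ padicValRat p W.j → Kato2004.ImageContainsSL2 W p → IsOf W p D →
    D.Divisibility

/-- **READING 3 — a datum EXISTS** (Kato 8.1 / Thm. 12.4 for the modules, Thm. 12.5 (4) for
`z ∈ 𝐇¹(T)`, §14.14 "by the argument as in 13.8" for (14.14.1); `Δ`-components split off exactly as
`#Δ ∣ p − 1`). Hypothesis schema; nothing asserted.
[cite: Kato2004Asterisque, 8.1 (p. 180), Thm. 12.4 (p. 221), Thm. 12.5 (4) (p. 222), §14.14 (p. 243), 13.8] -/
def Realizable : Prop :=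
  ∀ (W : WeierstrassCurve ℚ) [W.IsElliptic] [W.IsGloballyMinimal] (p : ℕ) [Fact p.Prime],
    p ≠ 2 → Addv W p → 0 ≤ padicValRat p W.j → Kato2004.ImageContainsSL2 W p →
    ∃ D : KatoDescentDatum p, IsOf W p D

/-- **INTERFACE LEMMA — what `KMC W p` means here**: Kato's Conj. 12.10 for `T_pW` on the
`Δ`-trivial component, read on any realised datum (`KMC W p ↔ D.Conj1210`). Both sides are
interfaces (D-O6-2 is not constructed); the O6 lane's `EvenComponentOfKMC` composes a full-`Λ`
`KMC` with this one. Hypothesis schema; nothing asserted. [cite: Kato2004Asterisque, Conj. 12.10 (p. 224)] -/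
def ReadsTrivialKMC : Prop :=
  ∀ (W : WeierstrassCurve ℚ) [W.IsElliptic] [W.IsGloballyMinimal] (p : ℕ) [Fact p.Prime]
    (D : KatoDescentDatum p), IsOf W p D → (KMC W p ↔ D.Conj1210)

/-- **Reading 1 is NOT weaker than the tree's Tamagawa-exact fact: it implies it** (drop `m ≥ 0`),
granted a datum exists (Reading 3). Consistency check of the schema against
`Kato2004.rankZero_padicValNat_sha_add_padicValNat_tamagawa_le_of_additive_potGood_of_imageContainsSL2`.
[cite: Kato2004Asterisque, Thm. 14.5 (3) (p. 236), Prop. 14.16 (2) (p. 244)] -/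
theorem descentCountReading_implies_tamagawaExact (hR : DescentCountReading IsOf)
    (hD : Realizable IsOf) :
    Kato2004.rankZero_padicValNat_sha_add_padicValNat_tamagawa_le_of_additive_potGood_of_imageContainsSL2 := by
  intro W _ _ p _ hp hng hnm hj hK hL hfin
  obtain ⟨D, hDof⟩ := hD W p hp ⟨hng, hnm⟩ hj hK
  obtain ⟨-, q, m, hq, -, hcount⟩ := hR W p D hp ⟨hng, hnm⟩ hj hK hL hfin hDof
  refine ⟨q, hq, ?_⟩
  have hm : (0 : ℤ) ≤ m := by positivity
  linarith

end Readings

/-! ## §3 The arithmetic of `#Ш_an` in rank `0` (kernel bookkeeping) -/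

section Arithmetic

variable (W : WeierstrassCurve ℚ) [W.IsElliptic] [W.IsGloballyMinimal] (p : ℕ) [Fact p.Prime]

omit [W.IsGloballyMinimal] in
/-- `E[p]` irreducible under (12.5.2) (`ρ̄_{E,p}` onto ⇒ irreducible; Serre). [cite: Kato2004Asterisque, (12.5.2) (p. 222)] -/
theorem irr_of_imageContainsSL2 (hK : Kato2004.ImageContainsSL2 W p) : Irr W p := by
  haveI : NeZero (p : ℚ) := ⟨by exact_mod_cast (Fact.out : p.Prime).ne_zero⟩
  exact hasIrreducibleModPGaloisRep_of_hasSurjectiveModNGaloisRep W p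
    (Kato2004.hasSurjectiveModNGaloisRep_of_imageContainsSL2 W p hK)

omit [W.IsGloballyMinimal] in
/-- **Rank-`0` bookkeeping: from `L(E,1)/Ω = q` and `ord_p #Ш(p) + v_p(Tam) + m = ord_p q` to
`#Ш_an = q·#tors²/Tam ∈ ℚ` with `ord_p #Ш_an = ord_p #Ш + m`** (`p ∤ #E(ℚ)_tors` as `E[p]` is
irreducible; `Reg = 1`, `L^{(0)}(E,1)/0! = L(E,1)`). [cite: Miller2011LMS, Def. 1.1] [cite: Mazur1977, Ch. III §5, p. 157] -/
theorem exists_shaAn_eq_of_count (hGZK : rank_eq_analyticRank_of_analyticRank_le_one)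
    (hr : W.analyticRank = 0) (hL : W.entireLFunction 1 ≠ 0) (hirr : Irr W p) {q : ℚ} {m : ℕ}
    (hq : W.entireLFunction 1 / (W.realPeriodRat : ℂ) = (q : ℂ))
    (hcount : (padicValNat p (Nat.card (AddCommGroup.primaryComponent W.sha p)) : ℤ) +
      padicValNat p W.tamagawaProduct + m = padicValRat p q) :
    ∃ q' : ℚ, shaAn W = (q' : ℂ) ∧ padicValRat p q' = padicValNat p W.shaOrder + m := by
  obtain ⟨hmw, hfin⟩ := hGZK W (by rw [hr]; exact zero_le_one)
  haveI : Finite W.sha := hfin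
  have hmw0 : W.mordellWeilRank = 0 := by rw [hmw, hr]
  have hΩpos : 0 < W.realPeriodRat := W.realPeriodRat_pos_holds
  have hΩ : (W.realPeriodRat : ℂ) ≠ 0 := by exact_mod_cast hΩpos.ne'
  have hc0 : 0 < W.tamagawaProduct := W.tamagawaProduct_pos_holds
  have ht0 : 0 < W.torsionOrder := W.torsionOrder_pos_holds
  have hq0 : q ≠ 0 := by
    rintro rfl
    rw [Rat.cast_zero, div_eq_zero_iff] at hq
    exact hq.elim hL hΩ
  refine ⟨q * (W.torsionOrder : ℚ) ^ 2 / (W.tamagawaProduct : ℚ), ?_, ?_⟩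
  · have hLq : W.entireLFunction 1 = (q : ℂ) * (W.realPeriodRat : ℂ) := by
      rw [← hq, div_mul_cancel₀ _ hΩ]
    rw [shaAn_def, leadingLCoeff_eq_of_analyticRank_eq_zero W hr,
      W.regulator_eq_one_of_rank_zero hmw0, hLq]
    push_cast
    field_simp
  · have ht : (W.torsionOrder : ℚ) ≠ 0 := by exact_mod_cast ht0.ne'
    have hcq : (W.tamagawaProduct : ℚ) ≠ 0 := by exact_mod_cast hc0.ne'
    have hsha : padicValNat p (Nat.card (AddCommGroup.primaryComponent W.sha p)) =
        padicValNat p W.shaOrder := by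
      unfold WeierstrassCurve.shaOrder
      exact padicValNat_card_addPrimaryComponent p
    have htors : padicValNat p W.torsionOrder = 0 :=
      padicValNat_torsionOrder_eq_zero_of_irreducible W p hirr
    have hv : padicValRat p (q * (W.torsionOrder : ℚ) ^ 2 / (W.tamagawaProduct : ℚ)) =
        padicValRat p q + 2 * (padicValNat p W.torsionOrder : ℤ) -
          (padicValNat p W.tamagawaProduct : ℤ) := by
      rw [padicValRat.div (mul_ne_zero hq0 (pow_ne_zero 2 ht)) hcq,
        padicValRat.mul hq0 (pow_ne_zero 2 ht), pow_two, padicValRat.mul ht ht,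
        padicValRat.of_nat, padicValRat.of_nat]
      ring
    rw [hv, htors, ← hsha]
    simp only [Nat.cast_zero, mul_zero, add_zero]
    linarith

omit [W.IsElliptic] [W.IsGloballyMinimal] [Fact p.Prime] in
/-- From `#Ш_an = q'` with `ord_p q' = ord_p #Ш + m`: the UPPER half always, and the LOWER half iff
`m = 0` (the rational value of `#Ш_an` is unique). [cite: Miller2011LMS, Def. 1.1] -/
theorem missingLowerBoundAt_iff_of_shaAn_eq {q' : ℚ} {m : ℕ} (hq' : shaAn W = (q' : ℂ))
    (hv : padicValRat p q' = padicValNat p W.shaOrder + m) :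
    MissingUpperBoundAt W p ∧ (MissingLowerBoundAt W p ↔ m = 0) := by
  have huniq : ∀ q'' : ℚ, shaAn W = (q'' : ℂ) → q'' = q' := fun q'' h => by
    exact_mod_cast h.symm.trans hq'
  refine ⟨⟨q', hq', by rw [hv]; exact_mod_cast Nat.le_add_right _ _⟩, ?_, ?_⟩
  · rintro ⟨q'', hq'', hle⟩
    rw [huniq q'' hq'', hv] at hle
    have : (m : ℤ) ≤ 0 := by linarith
    exact_mod_cast le_antisymm (by exact_mod_cast this) (Nat.zero_le m)
  · intro hm
    exact ⟨q', hq', by rw [hv, hm]; simp⟩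

end Arithmetic


end Summit.BirchSwinnertonDyer.Rank1Residual.Additive

end
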